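import Literature.MathematicalPhysics.QuantumLattice.PairFieldMomentum
import Literature.MathematicalPhysics.QuantumLattice.HubbardLSMFillingProofs
import HarnessLib

/-!
# Pinned spin-↑ gauge frame for `LadderThesis` (stmt-HubbardSuperconductivity-1890) — definitions

Objects of the crux idea `pinned-up-gauge-frame` (`Cruxes/LadderThesis/Ideas/pinned-up-gauge-frame.md`,
ideator 2, round 1) for the route `DeformationLadder`, stated in tree vocabulary:

* `upTwistAngle L k` — the angles of the FLAT spin-↑ twist of winding `k ∈ (ℤ/L)²`
  (`θ_k(x,↑) = Σᵢ p_i x_i`, `p = latticeMomentum L k = 2πk/L`; spin ↓ untouched); the unitary is the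
  tree's `fockTwist (upTwistAngle L k) = exp(i Σ_x θ_k(x) n_{x↑})`, and for `k = eᵢ` the angle
  function IS the Lieb–Schultz–Mattis twist `lsmTwist L i 0` (`upTwistAngle_single`, companion file).
* `upPair g L x = Σ_e g(e) c_{x↑} c_{x+e,↓}` — the bond pair annihilator in the spin-↑ convention
  (phase-carrying fermion at `x`), so that `pairField g L = √2 Σ_x upPair g L x` for even `g`.
* `upPairFieldAt g L k = √2 Σ_x conj χ_k(x) • upPair g L x` — the pair field at pair momentum `k` in
  the spin-↑ convention (sign convention of the tree's `pairFieldAt`, from which it differs by the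
  bond factor `(1 + conj χ_k(e))/2`); it is the EXACT image of `pairField g L` under the flat spin-↑
  twist (`fockTwist_conj_pairField`, companion file `…PinnedFrameCovariance.lean`).

References: P. Fulde, R. A. Ferrell, Phys. Rev. 135 (1964) A550 (finite-momentum pairing);
E. Lieb, T. Schultz, D. Mattis, Ann. Phys. 16 (1961) 407, App. B (the twist);
D. J. Scalapino, Phys. Rep. 250 (1995) 329, §2 (the `d_{x²-y²}` pair field).
-/

noncomputable section

namespace Summit.HubbardSuperconductivity.HubbardSuperconductivity.Theorems.PinnedFrame

set_option linter.dupNamespace false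

open Matrix Finset Complex Literature.MathematicalPhysics.QuantumLattice
  Literature.Probability.LatticeModels HubbardWave0
open scoped ComplexOrder ComplexConjugate Matrix.Norms.L2Operator

variable (g : Site 2 → ℝ) (L : ℕ)

/-- The **flat spin-↑ twist angles of winding `k ∈ (ℤ/L)²`**: the spin-↑ orbital at the torus
site `x` carries the angle `θ_k(x) = Σᵢ p_i x_i` with `p = latticeMomentum L k = 2πk/L` and the
canonical representatives `x_i ∈ {0,…,L-1}`; spin-↓ orbitals are untouched. For `k = eᵢ` this is
the Lieb–Schultz–Mattis twist `lsmTwist L i 0`. The associated diagonal unitary of Fock space is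
the tree's `fockTwist (upTwistAngle L k) = exp(i Σ_x θ_k(x) n_{x↑})`.
Lieb–Schultz–Mattis, Ann. Phys. 16 (1961) 407, App. B; Fulde–Ferrell, Phys. Rev. 135 (1964) A550. [folklore] -/
def upTwistAngle (k : TorusSite 2 L) : Orb (FermionTorus 2 L) → ℝ := fun o =>
  if (ofLex o).2 = 0 then
    ∑ i : Fin 2, latticeMomentum L k i * ((ofLex (ofLex o).1 i : ℕ) : ℝ)
  else 0

/-- Spin-↓ orbitals are not twisted: `θ_k(y, ↓) = 0`. [folklore] -/
@[simp] theorem upTwistAngle_orb_down (k : TorusSite 2 L) (y : FermionTorus 2 L) :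
    upTwistAngle L k (orb y 1) = 0 := by
  simp [upTwistAngle]

variable [NeZero L]

/-- The **spin-↑-based bond pair annihilator** `Q_x = Σ_{e ∈ {0,±e₁,±e₂}} g(e) c_{x↑} c_{x+e,↓}`
with form factor `g` (no singlet symmetrisation: the phase-carrying ↑ fermion sits at `x`).
Summed over `x`, `√2 Σ_x Q_x` is the tree's singlet pair field `pairField g L` whenever `g` is
even (`pairField_eq_sqrt_two_smul_sum_upPair`). Scalapino, Phys. Rep. 250 (1995) 329, §2. [folklore] -/
def upPair (x : TorusSite 2 L) :
    Matrix (Finset (Orb (FermionTorus 2 L))) (Finset (Orb (FermionTorus 2 L))) ℂ :=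
  ∑ e ∈ insert (0 : Site 2) unitSteps, ((g e : ℝ) : ℂ) •
    (annihilation (orb (FermionTorus.ofTorusSite x) 0) *
      annihilation (orb (FermionTorus.ofTorusSite (x + Torus.proj L e)) 1))

/-- The **pair field at pair momentum `k` in the spin-↑ convention**,
`Δ↑_g(k) = √2 Σ_x conj χ_k(x) • Q_x` (`χ_k` the torus character `torusChar`, same sign convention
as the tree's momentum-resolved singlet pair field `pairFieldAt`, from which it differs by the
bond factor `(1 + conj χ_k(e))/2`): the EXACT image of the zero-momentum pair field under the flat
spin-↑ twist of winding `k` (`fockTwist_conj_pairField`). Fulde–Ferrell, Phys. Rev. 135 (1964)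
A550 (finite-momentum pairing); Scalapino, Phys. Rep. 250 (1995) 329, §2. [folklore] -/
def upPairFieldAt (k : TorusSite 2 L) :
    Matrix (Finset (Orb (FermionTorus 2 L))) (Finset (Orb (FermionTorus 2 L))) ℂ :=
  ((Real.sqrt 2 : ℝ) : ℂ) • ∑ x : TorusSite 2 L, conj (torusChar k x) • upPair g L x

/-! ### The twist angles and the torus characters -/

/-- The twist angle of the spin-↑ orbital at `x`: `θ_k(x, ↑) = Σᵢ p_i x_i`. [folklore] -/
theorem upTwistAngle_orb_up (k x : TorusSite 2 L) :
    upTwistAngle L k (orb (FermionTorus.ofTorusSite x) 0) =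
      ∑ i : Fin 2, latticeMomentum L k i * ((x i).val : ℝ) := by
  unfold upTwistAngle
  rw [if_pos (show (ofLex (orb (FermionTorus.ofTorusSite x) (0 : Fin 2))).2 = 0 from rfl)]
  rfl

/-- The torus character as the exponential of the lattice-momentum phase:
`χ_k(x) = exp(i Σᵢ p_i x_i)`, `p = 2πk/L`. Friedli–Velenik (2017) §10.4. [folklore] -/
theorem torusChar_eq_cexp (k x : TorusSite 2 L) :
    torusChar k x = cexp ((∑ i : Fin 2, latticeMomentum L k i * ((x i).val : ℝ) : ℝ) * I) := by
  unfold torusChar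
  simp_rw [stdAddChar_mul_eq_exp, ← Complex.exp_sum]
  congr 1
  push_cast
  rw [Finset.sum_mul]
  refine Finset.sum_congr rfl fun i _ => ?_
  simp only [latticeMomentum]
  push_cast
  ring

/-- The inverse twist phase of the spin-↑ orbital at `x` is the conjugate character:
`exp(-i θ_k(x,↑)) = conj χ_k(x)`. [folklore] -/
theorem cexp_neg_upTwistAngle_orb_up (k x : TorusSite 2 L) :
    cexp (-((upTwistAngle L k (orb (FermionTorus.ofTorusSite x) 0) : ℂ) * I)) =
      conj (torusChar k x) := by
  rw [upTwistAngle_orb_up, torusChar_eq_cexp, ← Complex.exp_conj, map_mul, Complex.conj_ofReal,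
    Complex.conj_I, mul_neg]

end Summit.HubbardSuperconductivity.HubbardSuperconductivity.Theorems.PinnedFrame
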